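import Summits.AtomisticToContinuum.Crystallization.Theorems.CoarseGrains.Negative.PredicateAPI

/-!
# Line `Sketch` (crux `FineGrains`, stmt-AtomisticToContinuum-9330): local flatness ⇒ fineness

Stub `stub_localFlatness` of the line skeleton (card tube-energy-gap-pigeonhole, step P2).

Setting: an admissible `Inner` datum `(t, A)`, a cluster `y : Fin n → ℝ³` with every particle within
`1/40` of its assigned site `t (m i) + A (z i)` (`z i ∈ Λ`), two-way `1/40`-matched with the sites on
`B_{ρ+8}(c')`, and a *relaxed* displacement `v i := y i − (t (m i) + d (m i) + A (z i))`
(`‖d k‖ ≤ 1`) whose local quadratic form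
`S := Σ_{i,j} [y i, y j ∈ B_{ρ+5}(c'), dist (y i) (y j) ≤ 4] ‖v i − v j‖²` is at most `θ`.
Claim: for `θ := (ε/(ρ+8))²` the cluster is `ε`-fine on `B_ρ(c')` for the re-fitted datum
`t' k := t k + d k + v i₀`, `A' := A`, where `y i₀` is a particle within `9/8` of `c'`.

Proof (all `[folklore]`):
* every term of `S` is `≤ θ`, so `‖v i − v j‖ ≤ s := ε/(ρ+8)` for every admissible pair;
* every point `p` of `B_{ρ+3}(c')` has a particle within `9/8` (a site within `11/10` by
  `exists_site_near`, which is within `ρ + 8` of `c'` and so owns a particle at `1/40`);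
* chain lemma (induction on `k`): every `p ∈ B_{ρ+3}(c')` with `dist p (y i₀) ≤ k` has a particle
  `y i` within `9/8` with `‖v i − v i₀‖ ≤ k s` — step from `k` to `k + 1` through the point of the
  segment `[y i₀, p]` one unit from `p` (convexity keeps it in the ball), consecutive chain particles
  being `≤ 9/8 + 1 + 9/8 ≤ 4` apart and within `ρ + 3 + 9/8 ≤ ρ + 5` of `c'`;
* hence the oscillation `‖v j − v i₀‖ ≤ (⌈ρ + 33/8⌉₊ + 1) s ≤ (ρ + 8) s = ε` on `B_{ρ+3}(c')`;
* clause (i) of `Near` at radius `ρ`: `dist (y j) (t' (m j) + A (z j)) = ‖v j − v i₀‖ ≤ ε`;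
  clause (ii): a new site `t' μ + A ζ` within `ρ` of `c'` has its old site `t μ + A ζ` within
  `ρ + 81/40 ≤ ρ + 8`, which owns a particle `y j` at `1/40`; by `site_eq_of_dist_lt` the old site IS
  the assigned site of `j` (`μ = m j`, `ζ = z j`), so `dist (y j) (t' μ + A ζ) = ‖v j − v i₀‖ ≤ ε`.
Nothing here closes an item; `Adm A'` is the hypothesis `Adm A`.
-/

noncomputable section

namespace Summit.AtomisticToContinuum.Crystallization.Theorems.ExcessDecayLiouvilleFineGrains

open Literature.MathematicalPhysics.StatisticalMechanics
open Summit.AtomisticToContinuum.Crystallization.Theorems.CoarseGrains.Negative.PredicateAPI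

/-! ### Elementary pieces -/

/-- A single term of a double sum of nonnegative reals is at most the sum. [folklore] -/
private theorem single_le_double_sum {n : ℕ} (f : Fin n → Fin n → ℝ) (hf : ∀ i j, 0 ≤ f i j)
    (i j : Fin n) : f i j ≤ ∑ i', ∑ j', f i' j' :=
  calc f i j ≤ ∑ j', f i j' := Finset.single_le_sum (fun j' _ => hf i j') (Finset.mem_univ j)
    _ ≤ ∑ i', ∑ j', f i' j' :=
      Finset.single_le_sum (f := fun i' => ∑ j', f i' j')
        (fun i' _ => Finset.sum_nonneg fun j' _ => hf i' j') (Finset.mem_univ i)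

/-- Step point: given `a, p` in the ball `B_r(c)` with `dist p a ≤ k + 1` (`k ≥ 0`), there is a point
of `B_r(c)` within `1` of `p` and within `k` of `a` (`a` itself if `dist p a ≤ 1`, else the point of
the segment `[a, p]` one unit from `p`). [folklore] -/
private theorem exists_step_point {a p c : E3} {r k : ℝ} (hk : 0 ≤ k) (ha : dist a c ≤ r)
    (hp : dist p c ≤ r) (hpa : dist p a ≤ k + 1) :
    ∃ p' : E3, dist p' p ≤ 1 ∧ dist p' a ≤ k ∧ dist p' c ≤ r := by
  rcases le_or_gt (dist p a) 1 with hD | hD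
  · exact ⟨a, by rwa [dist_comm], by rw [dist_self]; exact hk, ha⟩
  · set D : ℝ := dist p a with hDdef
    have hD0 : 0 < D := by linarith
    have hinv0 : 0 ≤ D⁻¹ := inv_nonneg.2 hD0.le
    have hinv1 : D⁻¹ ≤ 1 := inv_le_one_of_one_le₀ hD.le
    have h1 : 0 ≤ 1 - D⁻¹ := by linarith
    refine ⟨p + D⁻¹ • (a - p), ?_, ?_, ?_⟩
    · rw [dist_eq_norm, add_sub_cancel_left, norm_smul, Real.norm_of_nonneg hinv0, ← dist_eq_norm,
        dist_comm, ← hDdef, inv_mul_cancel₀ hD0.ne']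
    · have e : p + D⁻¹ • (a - p) - a = (1 - D⁻¹) • (p - a) := by
        rw [sub_smul, one_smul, smul_sub, smul_sub]; abel
      rw [dist_eq_norm, e, norm_smul, Real.norm_of_nonneg h1, ← dist_eq_norm, ← hDdef, sub_mul,
        inv_mul_cancel₀ hD0.ne', one_mul]
      linarith
    · have e : p + D⁻¹ • (a - p) - c = (1 - D⁻¹) • (p - c) + D⁻¹ • (a - c) := by
        rw [sub_smul, one_smul, smul_sub, smul_sub, smul_sub]; abel
      rw [dist_eq_norm, e]
      calc ‖(1 - D⁻¹) • (p - c) + D⁻¹ • (a - c)‖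
          ≤ ‖(1 - D⁻¹) • (p - c)‖ + ‖D⁻¹ • (a - c)‖ := norm_add_le _ _
        _ = (1 - D⁻¹) * dist p c + D⁻¹ * dist a c := by
          rw [norm_smul, norm_smul, Real.norm_of_nonneg h1, Real.norm_of_nonneg hinv0,
            dist_eq_norm, dist_eq_norm]
        _ ≤ (1 - D⁻¹) * r + D⁻¹ * r := by gcongr
        _ = r := by ring

/-! ### The chain lemma -/

section Chain

variable {n : ℕ} {y v : Fin n → E3} {c' : E3} {ρ s : ℝ} {i₀ : Fin n}

/-- Chain lemma: if every point of `B_{ρ+3}(c')` has a particle within `9/8` and admissible pairs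
(both in `B_{ρ+5}(c')`, `≤ 4` apart) have `‖v i − v j‖ ≤ s`, then every point of `B_{ρ+3}(c')` at
distance `≤ k` from the reference particle `y i₀ ∈ B_{ρ+3}(c')` has a particle within `9/8` whose
displacement differs from `v i₀` by at most `k s`. [folklore] -/
private theorem chain
    (hP : ∀ p : E3, dist p c' ≤ ρ + 3 → ∃ i, dist (y i) p ≤ 9 / 8)
    (hv : ∀ i j, dist (y i) c' ≤ ρ + 5 → dist (y j) c' ≤ ρ + 5 → dist (y i) (y j) ≤ 4 →
      ‖v i - v j‖ ≤ s)
    (hi₀ : dist (y i₀) c' ≤ ρ + 3) :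
    ∀ (k : ℕ) (p : E3), dist p c' ≤ ρ + 3 → dist p (y i₀) ≤ k →
      ∃ i, dist (y i) p ≤ 9 / 8 ∧ ‖v i - v i₀‖ ≤ k * s := by
  intro k
  induction k with
  | zero =>
    intro p hpc hp0
    have hp : p = y i₀ := dist_le_zero.1 (by exact_mod_cast hp0)
    subst hp
    exact ⟨i₀, by rw [dist_self]; norm_num, by simp⟩
  | succ k ih =>
    intro p hpc hpk
    push_cast at hpk ⊢
    obtain ⟨p', hp'p, hp'a, hp'c⟩ := exists_step_point k.cast_nonneg hi₀ hpc hpk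
    obtain ⟨i', hi'p', hi'v⟩ := ih p' hp'c hp'a
    obtain ⟨i, hip⟩ := hP p hpc
    refine ⟨i, hip, ?_⟩
    have h1 : dist (y i) (y i') ≤ 4 := by
      linarith [dist_triangle4 (y i) p p' (y i'), dist_comm p' p, dist_comm (y i') p']
    have h2 : dist (y i) c' ≤ ρ + 5 := by linarith [dist_triangle (y i) p c']
    have h3 : dist (y i') c' ≤ ρ + 5 := by linarith [dist_triangle (y i') p' c']
    calc ‖v i - v i₀‖ ≤ ‖v i - v i'‖ + ‖v i' - v i₀‖ := norm_sub_le_norm_sub_add_norm_sub _ _ _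
      _ ≤ s + k * s := add_le_add (hv i i' h2 h3 h1) hi'v
      _ = (k + 1) * s := by ring

/-- Oscillation bound: under the hypotheses of `chain` with the reference particle within `9/8` of
`c'` (`ρ > 0`), every particle of `B_{ρ+3}(c')` has `‖v j − v i₀‖ ≤ (ρ + 8) s`. [folklore] -/
private theorem osc_le (hρ : 0 < ρ) (hs : 0 ≤ s)
    (hP : ∀ p : E3, dist p c' ≤ ρ + 3 → ∃ i, dist (y i) p ≤ 9 / 8)
    (hv : ∀ i j, dist (y i) c' ≤ ρ + 5 → dist (y j) c' ≤ ρ + 5 → dist (y i) (y j) ≤ 4 →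
      ‖v i - v j‖ ≤ s)
    (hi₀ : dist (y i₀) c' ≤ 9 / 8) {j : Fin n} (hj : dist (y j) c' ≤ ρ + 3) :
    ‖v j - v i₀‖ ≤ (ρ + 8) * s := by
  have hi₀' : dist (y i₀) c' ≤ ρ + 3 := by linarith
  have hD : dist (y j) (y i₀) ≤ ρ + 33 / 8 := by
    linarith [dist_triangle (y j) c' (y i₀), dist_comm c' (y i₀)]
  set k : ℕ := ⌈dist (y j) (y i₀)⌉₊ with hk
  have hk1 : dist (y j) (y i₀) ≤ k := Nat.le_ceil _
  have hk2 : (k : ℝ) < dist (y j) (y i₀) + 1 := Nat.ceil_lt_add_one dist_nonneg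
  obtain ⟨i, hij, hiv⟩ := chain hP hv hi₀' k (y j) hj hk1
  have h2 : dist (y i) c' ≤ ρ + 5 := by linarith [dist_triangle (y i) (y j) c']
  have h4 := hv i j h2 (by linarith) (by linarith)
  calc ‖v j - v i₀‖ ≤ ‖v j - v i‖ + ‖v i - v i₀‖ := norm_sub_le_norm_sub_add_norm_sub _ _ _
    _ ≤ s + k * s := by rw [norm_sub_rev]; exact add_le_add h4 hiv
    _ = (k + 1) * s := by ring
    _ ≤ (ρ + 8) * s := by apply mul_le_mul_of_nonneg_right _ hs; linarith

end Chain

/-! ### The re-fitted datum -/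

section Refit

variable {ρ ε s : ℝ} {c' : E3} {t : Fin 2 → E3} {A : E3 →L[ℝ] E3} {n : ℕ} {y : Fin n → E3}
  {d : Fin 2 → E3} {m : Fin n → Fin 2} {z : Fin n → E3}

/-- Every point of `B_{ρ+3}(c')` has a particle within `9/8`: a site of sublattice `0` within `11/10`
(`exists_site_near`), which lies within `ρ + 8` of `c'` and therefore owns a particle at `1/40` by the
two-way matching. [folklore] -/
private theorem exists_particle_near (hA : Adm A)
    (hN : Near (Set.range y) c' (ρ + 8) t A (1 / 40)) {p : E3} (hp : dist p c' ≤ ρ + 3) :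
    ∃ i, dist (y i) p ≤ 9 / 8 := by
  obtain ⟨z₀, hz₀, hd⟩ := exists_site_near hA (t 0) p
  have h8 : dist (t 0 + A z₀) c' ≤ ρ + 8 := by linarith [dist_triangle (t 0 + A z₀) p c']
  obtain ⟨q, ⟨i, rfl⟩, hq⟩ := hN.2 0 z₀ hz₀ h8
  exact ⟨i, by linarith [dist_triangle (y i) (t 0 + A z₀) p]⟩

/-- The re-fit: with `s`-flat admissible pairs (`(ρ + 8) s ≤ ε`), the datum `t' k := t k + d k + v i₀`,
`A' := A` is two-way `ε`-matched with the cluster on `B_ρ(c')`. [folklore] -/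
private theorem near_refit (hρ : 0 < ρ) (hs : 0 ≤ s) (hsε : (ρ + 8) * s ≤ ε) (hA : Adm A)
    (hI : Inner t A) (hd : ∀ k : Fin 2, ‖d k‖ ≤ 1)
    (hsite : ∀ i : Fin n, z i ∈ Lam ∧ dist (y i) (t (m i) + A (z i)) ≤ 1 / 40)
    (hN : Near (Set.range y) c' (ρ + 8) t A (1 / 40)) (v : Fin n → E3)
    (hvdef : ∀ i, v i = y i - (t (m i) + d (m i) + A (z i)))
    (hv : ∀ i j, dist (y i) c' ≤ ρ + 5 → dist (y j) c' ≤ ρ + 5 → dist (y i) (y j) ≤ 4 →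
      ‖v i - v j‖ ≤ s) :
    ∃ t' : Fin 2 → E3, Near (Set.range y) c' ρ t' A ε := by
  have hP : ∀ p : E3, dist p c' ≤ ρ + 3 → ∃ i, dist (y i) p ≤ 9 / 8 :=
    fun p hp => exists_particle_near hA hN hp
  -- the reference particle
  obtain ⟨i₀, hi₀⟩ : ∃ i₀, dist (y i₀) c' ≤ 9 / 8 := hP c' (by rw [dist_self]; linarith)
  have hosc : ∀ j, dist (y j) c' ≤ ρ + 3 → ‖v j - v i₀‖ ≤ ε :=
    fun j hj => (osc_le hρ hs hP hv hi₀ hj).trans hsε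
  have hvi₀ : ‖v i₀‖ ≤ 41 / 40 := by
    have e : v i₀ = (y i₀ - (t (m i₀) + A (z i₀))) - d (m i₀) := by rw [hvdef]; abel
    rw [e]
    calc ‖(y i₀ - (t (m i₀) + A (z i₀))) - d (m i₀)‖
        ≤ ‖y i₀ - (t (m i₀) + A (z i₀))‖ + ‖d (m i₀)‖ := norm_sub_le _ _
      _ ≤ 1 / 40 + 1 := by rw [← dist_eq_norm]; exact add_le_add (hsite i₀).2 (hd _)
      _ = 41 / 40 := by norm_num
  -- distance of a particle to its re-fitted site
  have hnew : ∀ j, dist (y j) (t (m j) + d (m j) + v i₀ + A (z j)) = ‖v j - v i₀‖ := by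
    intro j
    rw [dist_eq_norm, hvdef j]
    congr 1
    abel
  refine ⟨fun k => t k + d k + v i₀, ?_, ?_⟩
  · -- clause (i): particles of `B_ρ(c')` are `ε`-close to their re-fitted sites
    rintro p ⟨j, rfl⟩ hj
    refine ⟨m j, z j, (hsite j).1, ?_⟩
    show dist (y j) (t (m j) + d (m j) + v i₀ + A (z j)) ≤ ε
    rw [hnew]
    exact hosc j (by linarith)
  · -- clause (ii): re-fitted sites of `B_ρ(c')` own a particle at distance `ε`
    intro μ ζ hζ hμζ
    change dist (t μ + d μ + v i₀ + A ζ) c' ≤ ρ at hμζ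
    show ∃ p ∈ Set.range y, dist p (t μ + d μ + v i₀ + A ζ) ≤ ε
    have hshift : dist (t μ + A ζ) (t μ + d μ + v i₀ + A ζ) ≤ 81 / 40 := by
      have e : t μ + A ζ - (t μ + d μ + v i₀ + A ζ) = -(d μ + v i₀) := by abel
      rw [dist_eq_norm, e, norm_neg]
      linarith [norm_add_le (d μ) (v i₀), hd μ]
    have hold : dist (t μ + A ζ) c' ≤ ρ + 8 := by
      linarith [dist_triangle (t μ + A ζ) (t μ + d μ + v i₀ + A ζ) c']
    obtain ⟨p, ⟨j, rfl⟩, hj⟩ := hN.2 μ ζ hζ hold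
    obtain ⟨hμ, hζz⟩ := site_eq_of_dist_lt hA hI hζ (hsite j).1 hj (hsite j).2
    subst hμ hζz
    refine ⟨y j, ⟨j, rfl⟩, ?_⟩
    rw [hnew]
    refine hosc j ?_
    linarith [dist_triangle (y j) (t (m j) + A (z j)) c',
      dist_triangle (t (m j) + A (z j)) (t (m j) + d (m j) + v i₀ + A (z j)) c']

end Refit

/-! ### The stub -/

/-- **Local flatness ⇒ fineness** (stub `stub_localFlatness` of line `Sketch`, crux `FineGrains`
stmt-AtomisticToContinuum-9330, step P2 of card tube-energy-gap-pigeonhole).  If the local quadratic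
form of the relaxed displacement `v i = y i − (t (m i) + d (m i) + A (z i))` on `B_{ρ+5}(c')` is at
most `θ := (ε/(ρ+8))²`, then the cluster is `ε`-fine on `B_ρ(c')` for the re-fitted datum
`t' k = t k + d k + v i₀`, `A' = A` (chain lemma `chain`/`osc_le` + re-fit `near_refit`). [folklore] -/
theorem stub_localFlatness :
    ∀ ρ ε : ℝ, 0 < ρ → 0 < ε → ∃ θ : ℝ, 0 < θ ∧
    ∀ (c' : E3) (t : Fin 2 → E3) (A : E3 →L[ℝ] E3), Adm A → Inner t A →
    ∀ (n : ℕ) (y : Fin n → E3) (d : Fin 2 → E3) (m : Fin n → Fin 2) (z : Fin n → E3),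
      (∀ k : Fin 2, ‖d k‖ ≤ 1) →
      (∀ i : Fin n, z i ∈ Lam ∧ dist (y i) (t (m i) + A (z i)) ≤ 1 / 40) →
      Near (Set.range y) c' (ρ + 8) t A (1 / 40) →
      (∑ i : Fin n, ∑ j : Fin n,
          if dist (y i) c' ≤ ρ + 5 ∧ dist (y j) c' ≤ ρ + 5 ∧ dist (y i) (y j) ≤ 4 then
            ‖(y i - (t (m i) + d (m i) + A (z i))) - (y j - (t (m j) + d (m j) + A (z j)))‖ ^ 2
          else 0) ≤ θ →
      ∃ (t' : Fin 2 → E3) (A' : E3 →L[ℝ] E3), Adm A' ∧ Near (Set.range y) c' ρ t' A' ε := by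
  intro ρ ε hρ hε
  have hρ8 : 0 < ρ + 8 := by linarith
  refine ⟨(ε / (ρ + 8)) ^ 2, by positivity, ?_⟩
  intro c' t A hA hI n y d m z hd hsite hN hS
  set s : ℝ := ε / (ρ + 8) with hs_def
  have hs : 0 < s := by positivity
  have hsε : (ρ + 8) * s ≤ ε := by rw [hs_def, mul_div_cancel₀ _ hρ8.ne']
  -- every admissible pair is `s`-flat
  have hv : ∀ i j, dist (y i) c' ≤ ρ + 5 → dist (y j) c' ≤ ρ + 5 → dist (y i) (y j) ≤ 4 →
      ‖(y i - (t (m i) + d (m i) + A (z i))) - (y j - (t (m j) + d (m j) + A (z j)))‖ ≤ s := by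
    intro i j hi hj hij
    have h1 := single_le_double_sum (fun i j =>
      if dist (y i) c' ≤ ρ + 5 ∧ dist (y j) c' ≤ ρ + 5 ∧ dist (y i) (y j) ≤ 4 then
        ‖(y i - (t (m i) + d (m i) + A (z i))) - (y j - (t (m j) + d (m j) + A (z j)))‖ ^ 2
      else 0) (fun i j => by split_ifs <;> positivity) i j
    have h2 := h1.trans hS
    rw [if_pos ⟨hi, hj, hij⟩] at h2
    exact (pow_le_pow_iff_left₀ (norm_nonneg _) hs.le two_ne_zero).1 h2
  obtain ⟨t', ht'⟩ := near_refit hρ hs.le hsε hA hI hd hsite hN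
    (fun i => y i - (t (m i) + d (m i) + A (z i))) (fun i => rfl) hv
  exact ⟨t', A, hA, ht'⟩

end Summit.AtomisticToContinuum.Crystallization.Theorems.ExcessDecayLiouvilleFineGrains

end
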